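import Summits.AtomisticToContinuum.BoseEinsteinCondensation.Theses.BECPhaseQuadratureSumRule
import Summits.AtomisticToContinuum.BoseEinsteinCondensation.Theorems.BECPhaseQuadratureSumRuleSumRuleChainGlueModes
import Summits.AtomisticToContinuum.BoseEinsteinCondensation.Theorems.BECPhaseQuadratureSumRuleSumRuleChainGlueClosePairs
import Summits.AtomisticToContinuum.BoseEinsteinCondensation.Theorems.BECPhaseQuadratureSumRuleSumRuleChainGlueDichotomy
import Summits.AtomisticToContinuum.BoseEinsteinCondensation.Theorems.BECPhaseQuadratureSumRuleSumRuleChainGlueScales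
import Literature.MathematicalPhysics.QuantumManyBody.BoseGasThermodynamicLimitRuelle
import HarnessLib

/-!
# Route `BECPhaseQuadratureSumRule` — the glue `SumRuleChainGlue` (stmt-AtomisticToContinuum-12627)

`MinimiserRegularity → CouplingContinuity → NearMinimiserStability → CurrentSumRule → LongWaveStructureBound →
NonCondensateRemainders → CondensateNumberConcentration → SmoothPeriodicBEC`, proved as stated, with `c = 1/2`.

For a smooth-class `v` (range `R₀ ≥ 1`, edge constant `Cₑ ≥ 0`): if `a(v) = 0` then `v(|x|) ≡ 0` (file `…Energy`),
the constant state is a minimiser with `n₀ = N`, and `NearMinimiserStability` (`ε = ½`) gives `n₀ ≥ N/2` near it.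
If `a(v) > 0`: constants `Λ²a = 1024πR₀` (ultraviolet tail `N²/64`), `ζ = ε_R = 1/64`, `ε_L = 25/4096`, `K = Λ`,
boxes `ℓ = (Λ√(ρa))⁻¹`, `η = ρ^{3/4}`, budget `E_b = 16πR₀ρN`; `dichotomy_of_instances` turns the instances at a
torus state of `CurrentSumRule`, `NonCondensateRemainders`, `LongWaveStructureBound`,
`CondensateNumberConcentration` and the budget into `n₀ ∉ (N/4, 3N/4)` once the infrared current error `g(ρ)`
(`exists_errorThreshold`) is `≤ 1/32` (total error `1/64 + 5/64 = 3/32 < 3/16`); for `ρ` below all thresholds and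
`N = n + 2` large this applies to the minimisers `Ψ_t` of `-ΣΔ + tΣv^per`, `t ∈ (0,1]` (`MinimiserRegularity` on
`t·v`); `CouplingContinuity` (`ε = 1/8`, steps `δ/2` from the constant state at `t = 0`) forces `n₀(Ψ₁) ≥ 3N/4`,
and `NearMinimiserStability` (`ε = ¼`) gives `n₀ ≥ N/2` for all `δ`-near-minimisers of `v`.
-/

noncomputable section

open MeasureTheory Filter Set
open scoped ENNReal NNReal Topology BigOperators

namespace Summit.AtomisticToContinuum.BoseEinsteinCondensation.Theorems.SumRuleChainGlue

open Literature.MathematicalPhysics.QuantumManyBody.BoseGas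
open Summit.AtomisticToContinuum.BoseEinsteinCondensation.Theses.BECPhaseQuadratureSumRule

/-- **From the instances at a torus state to the dichotomy** (constants in the module docstring; `hS`, `hRem`, `hLW`,
`hV`, `hE` are the instances at `Ψ` of `CurrentSumRule`, `NonCondensateRemainders` (`Λ`, `ε_R = 1/64`),
`LongWaveStructureBound` (`K = Λ`, `ε_L = 25/4096`), `CondensateNumberConcentration` (`ζ = 1/64`), the budget). -/
theorem dichotomy_of_instances {n : ℕ} {L : ℝ} {v : ℝ → ℝ≥0∞} {R₀ Cₑ a Λ ρ t : ℝ} (hmeas : Measurable v)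
    (hR : ∀ r, R₀ < r → v r = 0) (hR₀ : 0 < R₀) (hfin : ∀ r, v r ≠ ⊤)
    (hC2 : ContDiff ℝ 2 fun x : Space => (v ‖x‖).toReal) (hCₑ : 0 ≤ Cₑ)
    (hedge : ∀ x : Space, ‖iteratedFDeriv ℝ 2 (fun x : Space => (v ‖x‖).toReal) x‖ ≤ Cₑ * Real.sqrt ((v ‖x‖).toReal))
    (ha : 0 < a) (hΛ : 0 < Λ) (hΛ2 : Λ ^ 2 * a = 1024 * Real.pi * R₀) (hρ : 0 < ρ) (ht : 0 < t) (ht1 : t ≤ 1)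
    (hL : 0 < L) (hρL : ρ * L ^ 3 = (n + 2 : ℕ))
    (h2R : 2 * R₀ < L) (hℓL : (Λ * Real.sqrt (ρ * a))⁻¹ < L)
    (hRℓ : 2 * R₀ ≤ (Λ * Real.sqrt (ρ * a))⁻¹) (hM : 1 ≤ L * (Λ * Real.sqrt (ρ * a)) / (2 * Real.pi))
    (hg : 384 * (Λ ^ 3 * a * Real.sqrt a * Real.sqrt ρ / (2 * Real.pi) ^ 3) +
      192 * (Λ ^ 2 * a / (2 * Real.pi) ^ 3) * Real.sqrt (192 * Real.pi * R₀ * ρ +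
        8 * R₀ ^ 2 * Cₑ * (1 + 25 / 4096) * (Real.sqrt (Real.sqrt ρ) / (Λ ^ 3 * a * Real.sqrt a)) +
        16 * Real.pi * R₀ ^ 3 * Cₑ * Real.sqrt (Real.sqrt ρ)) ≤ 1 / 32)
    (Ψ : PeriodicTrialState (n + 2) (L))
    (hE : periodicEnergy (fun r => ENNReal.ofReal t * v r) Ψ ≤ ENNReal.ofReal (16 * Real.pi * R₀ * ρ * ((n + 2 : ℕ) : ℝ)))
    (hS : ∀ p : Fin 3 → ℤ, p ≠ 0 → (∫⁻ X in cellN (n + 2) (L),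
        (‖currentAmp (L) p Ψ.ψ X‖₊ : ℝ≥0∞) ^ 2) ^ 2 ≤
      4 * (ENNReal.ofReal (((n + 2 : ℕ) : ℝ) * ‖kvec (L) p‖ ^ 2) *
        (ENNReal.ofReal (12 * ‖kvec (L) p‖ ^ 2) *
          (∑ j : Fin (n + 2), ∫⁻ X in cellN (n + 2) (L),
            (‖fderiv ℝ Ψ.ψ X (Pi.single j (kvec (L) p))‖₊ : ℝ≥0∞) ^ 2) +
        ENNReal.ofReal (((n + 2 : ℕ) : ℝ) * ‖kvec (L) p‖ ^ 6) +
        4 * ∫⁻ X in cellN (n + 2) (L), (∑ i : Fin (n + 2), ∑ j : Fin (n + 2) with i < j,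
          ENNReal.ofReal ((1 - Real.cos (inner ℝ (kvec (L) p) (X i - X j))) *
            |fderiv ℝ (fun z : Space => fderiv ℝ (fun z : Space => ∑' m : Fin 3 → ℤ,
              t * (v ‖z - latticeVec (L) m‖).toReal) z (kvec (L) p)) (X i - X j)
              (kvec (L) p)|)) * (‖Ψ.ψ X‖₊ : ℝ≥0∞) ^ 2)))
    (hRem : ∑' p : Fin 3 → ℤ, {p : Fin 3 → ℤ | p ≠ 0 ∧ ‖kvec (L) p‖ < Λ * Real.sqrt (ρ * a)}.indicator
      (fun p => (∫⁻ X in cellN (n + 2) (L), (‖currentAmpNc (L) p Ψ.ψ X‖₊ : ℝ≥0∞) ^ 2) /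
          ENNReal.ofReal (‖kvec (L) p‖ ^ 4) +
        ∫⁻ X in cellN (n + 2) (L), (‖densityAmpNc (L) p Ψ.ψ X‖₊ : ℝ≥0∞) ^ 2) p ≤
      ENNReal.ofReal (1 / 64 * ((n + 2 : ℕ) : ℝ) ^ 2))
    (hLW : ∫⁻ u in cell (L), ∫⁻ X in cellN (n + 2) (L),
        (∑ j : Fin (n + 2), ∑' m : Fin 3 → ℤ, (slidingBox (Λ * Real.sqrt (ρ * a))⁻¹ u).indicator (fun _ => (1 : ℝ≥0∞))
          (X j + latticeVec (L) m)) ^ 2 * (‖Ψ.ψ X‖₊ : ℝ≥0∞) ^ 2 ≤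
      ENNReal.ofReal ((1 + 25 / 4096) * (ρ * (Λ * Real.sqrt (ρ * a))⁻¹ ^ 3) ^ 2 * L ^ 3))
    (hV : ((n + 2 : ℕ) : ℝ≥0∞) * ((n + 1 : ℕ) : ℝ≥0∞) * (∫⁻ Y in cellN n (L),
        (‖∫ x in cell (L), ∫ y in cell (L),
          Ψ.ψ (Matrix.vecCons x (Matrix.vecCons y Y))‖₊ : ℝ≥0∞) ^ 2) / ENNReal.ofReal (L ^ 6) +
        condensateOccupation (n + 2) (L) Ψ.ψ ≤
      condensateOccupation (n + 2) (L) Ψ.ψ ^ 2 + ENNReal.ofReal (1 / 64 * ((n : ℝ) + 2) ^ 2)) :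
    condensateOccupation (n + 2) (L) Ψ.ψ ≤ ENNReal.ofReal (((n + 2 : ℕ) : ℝ) / 4) ∨
      ENNReal.ofReal (3 * ((n + 2 : ℕ) : ℝ) / 4) ≤ condensateOccupation (n + 2) (L) Ψ.ψ := by
  set N : ℝ := ((n + 2 : ℕ) : ℝ) with hN
  have hNpos : 0 < N := by rw [hN]; positivity
  set K₀ : ℝ := Λ * Real.sqrt (ρ * a) with hK₀
  have hK₀pos : 0 < K₀ := by rw [hK₀]; positivity
  set ℓ : ℝ := K₀⁻¹ with hℓ
  have hℓpos : 0 < ℓ := inv_pos.2 hK₀pos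
  set η : ℝ := Real.sqrt ρ * Real.sqrt (Real.sqrt ρ) with hη
  have hηpos : 0 < η := by rw [hη]; exact mul_pos (Real.sqrt_pos.2 hρ) (Real.sqrt_pos.2 (Real.sqrt_pos.2 hρ))
  set Eb : ℝ := 16 * Real.pi * R₀ * ρ * N with hEb
  have hEb0 : 0 ≤ Eb := by rw [hEb]; positivity
  have hℓR : ℓ / 2 ≤ ℓ - R₀ := by linarith
  have hRℓ' : R₀ ≤ ℓ := by linarith
  set Ecl : ℝ := (1 + 25 / 4096) * (ρ * ℓ ^ 3) ^ 2 * L ^ 3 / (ℓ - R₀) ^ 3 with hEcl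
  have hℓR0 : 0 < ℓ - R₀ := by linarith
  have hEcl0 : 0 ≤ Ecl := by rw [hEcl]; positivity
  have hclose : ∫⁻ X in cellN (n + 2) L, periodicInteraction ((Set.Iic R₀).indicator fun _ => (1 : ℝ≥0∞)) L X *
      (‖Ψ.ψ X‖₊ : ℝ≥0∞) ^ 2 ≤ ENNReal.ofReal Ecl := by
    have h := (closePairs_le_boxMoment hL hRℓ' Ψ).trans hLW
    have hc0 : ENNReal.ofReal ((ℓ - R₀) ^ 3) ≠ 0 := by
      rw [Ne, ENNReal.ofReal_eq_zero, not_le]; positivity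
    have hswap : (∫⁻ X in cellN (n + 2) L, periodicInteraction ((Set.Iic R₀).indicator fun _ => (1 : ℝ≥0∞)) L X *
        (‖Ψ.ψ X‖₊ : ℝ≥0∞) ^ 2) * ENNReal.ofReal ((ℓ - R₀) ^ 3) ≤ ENNReal.ofReal ((1 + 25 / 4096) * (ρ * ℓ ^ 3) ^ 2 * L ^ 3) := by
      rw [mul_comm]; exact h
    have h' : (∫⁻ X in cellN (n + 2) L, periodicInteraction ((Set.Iic R₀).indicator fun _ => (1 : ℝ≥0∞)) L X *
        (‖Ψ.ψ X‖₊ : ℝ≥0∞) ^ 2) ≤ ENNReal.ofReal ((1 + 25 / 4096) * (ρ * ℓ ^ 3) ^ 2 * L ^ 3) / ENNReal.ofReal ((ℓ - R₀) ^ 3) :=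
      (ENNReal.le_div_iff_mul_le (Or.inl hc0) (Or.inl ENNReal.ofReal_ne_top)).2 hswap
    refine h'.trans (le_of_eq ?_)
    rw [← ENNReal.ofReal_div_of_pos (by positivity)]
  have hT := tsum_pairOcc_ne_zero_le hmeas hR h2R hL hfin hC2 hCₑ hedge ht.le ht1 hηpos hEb0 hEcl0 hK₀pos hℓL
    (by norm_num : (0 : ℝ) ≤ 25 / 4096) hρL Ψ hE hclose hS hRem hLW
  have hWin := sum_window_current_le hL hK₀pos.le hNpos.le hM
    (δ' := (12 * Eb + 2 * (R₀ ^ 2 * Cₑ * η / 2 * Ecl + R₀ ^ 2 * Cₑ / (2 * η) * Eb)) / N)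
  have hδ : (12 * Eb + 2 * (R₀ ^ 2 * Cₑ * η / 2 * Ecl + R₀ ^ 2 * Cₑ / (2 * η) * Eb)) / N ≤
      192 * Real.pi * R₀ * ρ + 8 * R₀ ^ 2 * Cₑ * (1 + 25 / 4096) * (Real.sqrt (Real.sqrt ρ) / (Λ ^ 3 * a * Real.sqrt a)) +
        16 * Real.pi * R₀ ^ 3 * Cₑ * Real.sqrt (Real.sqrt ρ) := by
    have h1 : 12 * Eb / N = 192 * Real.pi * R₀ * ρ := by rw [hEb]; field_simp; ring
    have h2 : 2 * (R₀ ^ 2 * Cₑ / (2 * η) * Eb) / N = 16 * Real.pi * R₀ ^ 3 * Cₑ * Real.sqrt (Real.sqrt ρ) := by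
      rw [hEb, ← rho_div_eta hρ, hη]; field_simp
    have h3 : 2 * (R₀ ^ 2 * Cₑ * η / 2 * Ecl) / N ≤
        8 * R₀ ^ 2 * Cₑ * (1 + 25 / 4096) * (Real.sqrt (Real.sqrt ρ) / (Λ ^ 3 * a * Real.sqrt a)) := by
      rw [← eta_mul_rho_ell_cube hΛ hρ ha, ← hK₀, ← hℓ, hη]
      have hEclN : Ecl / N ≤ 8 * (1 + 25 / 4096) * ρ * ℓ ^ 3 := by
        rw [hEcl, ← hρL]
        rw [div_le_iff₀ (by positivity)]
        have hcube : (ℓ / 2) ^ 3 ≤ (ℓ - R₀) ^ 3 := pow_le_pow_left₀ (by positivity) hℓR 3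
        have hL3 : 0 < L ^ 3 := by positivity
        calc (1 + 25 / 4096) * (ρ * ℓ ^ 3) ^ 2 * L ^ 3 / (ℓ - R₀) ^ 3
            ≤ (1 + 25 / 4096) * (ρ * ℓ ^ 3) ^ 2 * L ^ 3 / (ℓ / 2) ^ 3 :=
              div_le_div_of_nonneg_left (by positivity) (by positivity) hcube
          _ = 8 * (1 + 25 / 4096) * ρ * ℓ ^ 3 * (ρ * L ^ 3) := by field_simp; ring
      have : 2 * (R₀ ^ 2 * Cₑ * (Real.sqrt ρ * Real.sqrt (Real.sqrt ρ)) / 2 * Ecl) / N =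
          R₀ ^ 2 * Cₑ * (Real.sqrt ρ * Real.sqrt (Real.sqrt ρ)) * (Ecl / N) := by field_simp
      rw [this]
      calc R₀ ^ 2 * Cₑ * (Real.sqrt ρ * Real.sqrt (Real.sqrt ρ)) * (Ecl / N)
          ≤ R₀ ^ 2 * Cₑ * (Real.sqrt ρ * Real.sqrt (Real.sqrt ρ)) * (8 * (1 + 25 / 4096) * ρ * ℓ ^ 3) :=
            mul_le_mul_of_nonneg_left hEclN (by positivity)
        _ = 8 * R₀ ^ 2 * Cₑ * (1 + 25 / 4096) * (Real.sqrt ρ * Real.sqrt (Real.sqrt ρ) * ρ * ℓ ^ 3) := by ring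
    have hsplit : (12 * Eb + 2 * (R₀ ^ 2 * Cₑ * η / 2 * Ecl + R₀ ^ 2 * Cₑ / (2 * η) * Eb)) / N =
        12 * Eb / N + 2 * (R₀ ^ 2 * Cₑ * η / 2 * Ecl) / N + 2 * (R₀ ^ 2 * Cₑ / (2 * η) * Eb) / N := by
      field_simp; ring
    rw [hsplit, h1, h2]
    linarith
  have hcur : 2 * N * (192 * (L * K₀ / (2 * Real.pi)) ^ 3 + 96 * Real.sqrt ((12 * Eb + 2 * (R₀ ^ 2 * Cₑ * η / 2 * Ecl +
      R₀ ^ 2 * Cₑ / (2 * η) * Eb)) / N) * (L / (2 * Real.pi)) * (L * K₀ / (2 * Real.pi)) ^ 2) ≤ 1 / 32 * N ^ 2 := by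
    rw [hK₀, window_cube_eq hρ ha hρL, show 96 * Real.sqrt ((12 * Eb + 2 * (R₀ ^ 2 * Cₑ * η / 2 * Ecl +
      R₀ ^ 2 * Cₑ / (2 * η) * Eb)) / N) * (L / (2 * Real.pi)) * (L * (Λ * Real.sqrt (ρ * a)) / (2 * Real.pi)) ^ 2 =
      96 * Real.sqrt ((12 * Eb + 2 * (R₀ ^ 2 * Cₑ * η / 2 * Ecl + R₀ ^ 2 * Cₑ / (2 * η) * Eb)) / N) *
        (L / (2 * Real.pi) * (L * (Λ * Real.sqrt (ρ * a)) / (2 * Real.pi)) ^ 2) by ring, window_sq_eq hρ ha hρL]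
    have hsq := Real.sqrt_le_sqrt hδ
    have h := mul_le_mul_of_nonneg_left hsq (by positivity : (0 : ℝ) ≤ 192 * (Λ ^ 2 * a / (2 * Real.pi) ^ 3))
    have hcoef : 384 * (Λ ^ 3 * a * Real.sqrt a * Real.sqrt ρ / (2 * Real.pi) ^ 3) +
        192 * (Λ ^ 2 * a / (2 * Real.pi) ^ 3) * Real.sqrt ((12 * Eb + 2 * (R₀ ^ 2 * Cₑ * η / 2 * Ecl +
          R₀ ^ 2 * Cₑ / (2 * η) * Eb)) / N) ≤ 1 / 32 := by linarith
    calc 2 * N * (192 * (N * (Λ ^ 3 * a * Real.sqrt a * Real.sqrt ρ / (2 * Real.pi) ^ 3)) +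
          96 * Real.sqrt ((12 * Eb + 2 * (R₀ ^ 2 * Cₑ * η / 2 * Ecl + R₀ ^ 2 * Cₑ / (2 * η) * Eb)) / N) *
            (N * (Λ ^ 2 * a / (2 * Real.pi) ^ 3)))
        = N ^ 2 * (384 * (Λ ^ 3 * a * Real.sqrt a * Real.sqrt ρ / (2 * Real.pi) ^ 3) +
            192 * (Λ ^ 2 * a / (2 * Real.pi) ^ 3) * Real.sqrt ((12 * Eb + 2 * (R₀ ^ 2 * Cₑ * η / 2 * Ecl +
              R₀ ^ 2 * Cₑ / (2 * η) * Eb)) / N)) := by ring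
      _ ≤ N ^ 2 * (1 / 32) := mul_le_mul_of_nonneg_left hcoef (sq_nonneg N)
      _ = 1 / 32 * N ^ 2 := by ring
  have hUV := uv_const_le hρ ha hR₀ hΛ2 n (Λ := Λ)
  have hmodes : ∑' p : Fin 3 → ℤ, (if p = 0 then 0 else pairOcc L p Ψ.ψ) ≤ ENNReal.ofReal (5 / 64 * N ^ 2) := by
    refine hT.trans ?_
    refine (add_le_add (add_le_add (add_le_add hUV le_rfl) le_rfl) hWin).trans ?_
    rw [← ENNReal.ofReal_add (by positivity) (by positivity), ← ENNReal.ofReal_add (by positivity) (by positivity),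
      ← ENNReal.ofReal_add (by positivity) (by positivity)]
    refine ENNReal.ofReal_le_ofReal ?_
    nlinarith [hcur]
  have hmain := card_mul_condensateOccupation_le hL Ψ (by norm_num : (0 : ℝ) ≤ 1 / 64) (by norm_num : (0 : ℝ) ≤ 5 / 64)
    hV hmodes
  exact condensateOccupation_dichotomy hL Ψ (by norm_num) (by norm_num) hmain

/-- **The infrared current error tends to zero with the density**: the threshold below which it is `≤ 1/32`. -/
theorem exists_errorThreshold (Λ a R₀ Cₑ : ℝ) :
    ∃ ρ₀ : ℝ, 0 < ρ₀ ∧ ∀ ρ : ℝ, 0 < ρ → ρ < ρ₀ →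
      384 * (Λ ^ 3 * a * Real.sqrt a * Real.sqrt ρ / (2 * Real.pi) ^ 3) +
        192 * (Λ ^ 2 * a / (2 * Real.pi) ^ 3) * Real.sqrt (192 * Real.pi * R₀ * ρ +
          8 * R₀ ^ 2 * Cₑ * (1 + 25 / 4096) * (Real.sqrt (Real.sqrt ρ) / (Λ ^ 3 * a * Real.sqrt a)) +
          16 * Real.pi * R₀ ^ 3 * Cₑ * Real.sqrt (Real.sqrt ρ)) ≤ 1 / 32 := by
  set g : ℝ → ℝ := fun ρ => 384 * (Λ ^ 3 * a * Real.sqrt a * Real.sqrt ρ / (2 * Real.pi) ^ 3) +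
    192 * (Λ ^ 2 * a / (2 * Real.pi) ^ 3) * Real.sqrt (192 * Real.pi * R₀ * ρ +
      8 * R₀ ^ 2 * Cₑ * (1 + 25 / 4096) * (Real.sqrt (Real.sqrt ρ) / (Λ ^ 3 * a * Real.sqrt a)) +
      16 * Real.pi * R₀ ^ 3 * Cₑ * Real.sqrt (Real.sqrt ρ)) with hg
  have hcont : Continuous g := by
    have hs : Continuous fun ρ : ℝ => Real.sqrt ρ := Real.continuous_sqrt
    have hss : Continuous fun ρ : ℝ => Real.sqrt (Real.sqrt ρ) := Real.continuous_sqrt.comp hs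
    refine ((continuous_const.mul ((continuous_const.mul hs).div_const _))).add
      ((continuous_const).mul (Real.continuous_sqrt.comp ?_))
    exact ((continuous_const.mul continuous_id).add (continuous_const.mul (hss.div_const _))).add
      (continuous_const.mul hss)
  have h0 : g 0 < 1 / 32 := by simp [hg]
  have hev : ∀ᶠ ρ in 𝓝 (0 : ℝ), g ρ < 1 / 32 := hcont.continuousAt.eventually (gt_mem_nhds h0)
  obtain ⟨ε, hε, hball⟩ := Metric.eventually_nhds_iff.1 hev
  refine ⟨ε, hε, fun ρ hρ hρε => le_of_lt ?_⟩
  have := hball (y := ρ) (by rw [Real.dist_eq, sub_zero, abs_of_pos hρ]; exact hρε)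
  simpa [hg] using this

/-- **The geometric threshold**: `ρ ≤ (4R₀²Λ²a)⁻¹` gives `2R₀ ≤ ℓ = (Λ√(ρa))⁻¹`. -/
theorem two_mul_le_ell {Λ a R₀ ρ : ℝ} (hΛ : 0 < Λ) (ha : 0 < a) (hR₀ : 0 < R₀) (hρ : 0 < ρ)
    (hρle : ρ ≤ (4 * R₀ ^ 2 * Λ ^ 2 * a)⁻¹) : 2 * R₀ ≤ (Λ * Real.sqrt (ρ * a))⁻¹ := by
  have hx : 0 < Λ * Real.sqrt (ρ * a) := by positivity
  have hc : 0 < 4 * R₀ ^ 2 * Λ ^ 2 * a := by positivity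
  have hsq : (2 * R₀ * (Λ * Real.sqrt (ρ * a))) ^ 2 ≤ 1 := by
    have hK : (Λ * Real.sqrt (ρ * a)) ^ 2 = Λ ^ 2 * (ρ * a) := by rw [mul_pow, Real.sq_sqrt (by positivity)]
    calc (2 * R₀ * (Λ * Real.sqrt (ρ * a))) ^ 2 = 4 * R₀ ^ 2 * (Λ * Real.sqrt (ρ * a)) ^ 2 := by ring
      _ = (4 * R₀ ^ 2 * Λ ^ 2 * a) * ρ := by rw [hK]; ring
      _ ≤ (4 * R₀ ^ 2 * Λ ^ 2 * a) * (4 * R₀ ^ 2 * Λ ^ 2 * a)⁻¹ := mul_le_mul_of_nonneg_left hρle hc.le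
      _ = 1 := mul_inv_cancel₀ hc.ne'
  have h1 : 2 * R₀ * (Λ * Real.sqrt (ρ * a)) ≤ 1 := by
    have h0 : 0 ≤ 2 * R₀ * (Λ * Real.sqrt (ρ * a)) := by positivity
    nlinarith
  calc 2 * R₀ = 2 * R₀ * (Λ * Real.sqrt (ρ * a)) * (Λ * Real.sqrt (ρ * a))⁻¹ := by field_simp
    _ ≤ 1 * (Λ * Real.sqrt (ρ * a))⁻¹ := mul_le_mul_of_nonneg_right h1 (by positivity)
    _ = _ := one_mul _

/-- Cancellation in `ℝ≥0∞`: `ofReal a ≤ x + ofReal b` with `b ≤ a` gives `ofReal (a - b) ≤ x`. -/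
theorem ofReal_sub_le_of_le_add {x : ℝ≥0∞} {a b : ℝ} (hb : 0 ≤ b) (hab : b ≤ a)
    (h : ENNReal.ofReal a ≤ x + ENNReal.ofReal b) : ENNReal.ofReal (a - b) ≤ x := by
  have hsplit : ENNReal.ofReal a = ENNReal.ofReal (a - b) + ENNReal.ofReal b := by
    rw [← ENNReal.ofReal_add (by linarith) hb, sub_add_cancel]
  rw [hsplit] at h
  exact (ENNReal.add_le_add_iff_right ENNReal.ofReal_ne_top).1 h

/-- **`SumRuleChainGlue`** (stmt-AtomisticToContinuum-12627 of route `BECPhaseQuadratureSumRule`):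
`MinimiserRegularity → CouplingContinuity → NearMinimiserStability → CurrentSumRule → LongWaveStructureBound →
NonCondensateRemainders → CondensateNumberConcentration → SmoothPeriodicBEC`, with `c = 1/2`. -/
theorem sumRuleChainGlue_proof : SumRuleChainGlue := by
  intro hMin hCC hNMS hCSR hLWB hNCR hCNC v hv hfin hC2 hedge
  have hcont : Continuous fun x : Space => (v ‖x‖).toReal := hC2.continuous
  obtain ⟨hmeas, R₀₀, hR₀₀⟩ := id hv
  set R₀ : ℝ := max R₀₀ 1 with hR₀def
  have hR₀ : 0 < R₀ := lt_of_lt_of_le one_pos (le_max_right _ _)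
  have hR : ∀ r, R₀ < r → v r = 0 := fun r hr => hR₀₀ r (lt_of_le_of_lt (le_max_left _ _) hr)
  by_cases ha0 : scatteringLength v = 0
  · -- the free case
    have h0 : ∀ x : Space, v ‖x‖ = 0 := pot_eq_zero_of_scatteringLength_eq_zero hv hfin hcont ha0
    refine ⟨1, one_pos, fun ρ hρ _ => ⟨1 / 2, by norm_num, ?_⟩⟩
    filter_upwards [eventually_gt_atTop 0] with N hN
    have hL : 0 < sideLength ρ N := by
      unfold sideLength; exact Real.rpow_pos_of_pos (div_pos (by exact_mod_cast hN) hρ) _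
    obtain ⟨Ψc, hEc0, hn0⟩ := exists_constState hL N
    have hEc : periodicEnergy v Ψc = 0 := by rw [periodicEnergy_eq_zero_pot h0, hEc0]
    have hGS : periodicGroundStateEnergy v N (sideLength ρ N) = 0 :=
      le_antisymm ((periodicGroundStateEnergy_le v Ψc).trans hEc.le) bot_le
    obtain ⟨δ, hδ, hstab⟩ := hNMS v hv hfin hC2 hedge N (sideLength ρ N) hL
      (by rw [hGS]; exact ENNReal.zero_ne_top) (1 / 2) (by norm_num)
    refine ⟨δ, hδ, fun Φ hΦ => ?_⟩
    have h := hstab Ψc Φ (by rw [hEc, hGS]) hΦ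
    rw [hn0] at h
    have hsplitN : (N : ℝ≥0∞) = ENNReal.ofReal (1 / 2 * N) + ENNReal.ofReal (1 / 2 * N) := by
      rw [← ENNReal.ofReal_add (by positivity) (by positivity), ← ENNReal.ofReal_natCast]; congr 1; ring
    rw [hsplitN] at h
    exact (ENNReal.add_le_add_iff_right ENNReal.ofReal_ne_top).1 h
  · -- the interacting case
    have hatop : scatteringLength v ≠ ⊤ := hv.scatteringLength_ne_top
    set a : ℝ := (scatteringLength v).toReal with hadef
    have ha : 0 < a := ENNReal.toReal_pos ha0 hatop
    obtain ⟨Cₑ₀, hCₑ₀⟩ := id hedge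
    set Cₑ : ℝ := max Cₑ₀ 0 with hCₑdef
    have hCₑ : 0 ≤ Cₑ := le_max_right _ _
    have hedge' : ∀ x : Space, ‖iteratedFDeriv ℝ 2 (fun x : Space => (v ‖x‖).toReal) x‖ ≤ Cₑ * Real.sqrt ((v ‖x‖).toReal) :=
      fun x => (hCₑ₀ x).trans (mul_le_mul_of_nonneg_right (le_max_left _ _) (Real.sqrt_nonneg _))
    set Λ : ℝ := Real.sqrt (1024 * Real.pi * R₀ / a) with hΛdef
    have hΛ : 0 < Λ := by rw [hΛdef]; exact Real.sqrt_pos.2 (by positivity)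
    have hΛ2 : Λ ^ 2 * a = 1024 * Real.pi * R₀ := by
      rw [hΛdef, Real.sq_sqrt (by positivity)]; field_simp
    obtain ⟨ρV, hρV, hV⟩ := hCNC v hv hfin hC2 hedge (1 / 64) (by norm_num)
    obtain ⟨ρR, hρR, hRc⟩ := hNCR v hv hfin hC2 hedge Λ hΛ (1 / 64) (by norm_num)
    obtain ⟨ρL, hρL, hLc⟩ := hLWB v hv hfin hC2 hedge Λ hΛ (25 / 4096) (by norm_num)
    obtain ⟨ρE, hρE, hEc⟩ := periodicEnergy_le_of_minimiser_uniform hR₀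
    obtain ⟨ρg, hρg, hg⟩ := exists_errorThreshold Λ a R₀ Cₑ
    set ρ₇ : ℝ := (4 * R₀ ^ 2 * Λ ^ 2 * a)⁻¹ with hρ₇
    have hρ₇pos : 0 < ρ₇ := by rw [hρ₇]; positivity
    refine ⟨min (min (min ρV ρR) (min ρL ρE)) (min ρg ρ₇), by positivity, fun ρ hρ hρlt => ?_⟩
    have hρV' : ρ < ρV := lt_of_lt_of_le hρlt ((min_le_left _ _).trans ((min_le_left _ _).trans (min_le_left _ _)))
    have hρR' : ρ < ρR := lt_of_lt_of_le hρlt ((min_le_left _ _).trans ((min_le_left _ _).trans (min_le_right _ _)))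
    have hρL' : ρ < ρL := lt_of_lt_of_le hρlt ((min_le_left _ _).trans ((min_le_right _ _).trans (min_le_left _ _)))
    have hρE' : ρ < ρE := lt_of_lt_of_le hρlt ((min_le_left _ _).trans ((min_le_right _ _).trans (min_le_right _ _)))
    have hρg' : ρ < ρg := lt_of_lt_of_le hρlt ((min_le_right _ _).trans (min_le_left _ _))
    have hρ₇' : ρ ≤ ρ₇ := (lt_of_lt_of_le hρlt ((min_le_right _ _).trans (min_le_right _ _))).le
    have hRℓ : 2 * R₀ ≤ (Λ * Real.sqrt (ρ * a))⁻¹ := two_mul_le_ell hΛ ha hR₀ hρ hρ₇'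
    have hK₀ : 0 < Λ * Real.sqrt (ρ * a) := by positivity
    refine ⟨1 / 2, by norm_num, ?_⟩
    have hTL := tendsto_sideLength_atTop hρ
    have hev := (((tendsto_add_atTop_nat 2).eventually (hRc ρ hρ hρR')).and
      (((tendsto_add_atTop_nat 2).eventually (hLc ρ hρ hρL')).and
      (((tendsto_add_atTop_nat 2).eventually (hEc ρ hρ hρE')).and
      (((tendsto_add_atTop_nat 2).eventually ((hTL.eventually_gt_atTop (2 * R₀)).and
        ((hTL.eventually_gt_atTop (Λ * Real.sqrt (ρ * a))⁻¹).and
        (hTL.eventually_ge_atTop (2 * Real.pi / (Λ * Real.sqrt (ρ * a))))))))))).and (hV ρ hρ hρV')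
    rw [Filter.eventually_atTop] at hev ⊢
    obtain ⟨n₀, hn₀⟩ := hev
    refine ⟨n₀ + 2, fun N hN => ?_⟩
    obtain ⟨n, rfl⟩ : ∃ n, N = n + 2 := ⟨N - 2, by omega⟩
    obtain ⟨⟨h2, h3, h4, h2R, hℓL, hML⟩, h1⟩ := hn₀ n (by omega)
    set L : ℝ := sideLength ρ (n + 2) with hLdef
    have hL : 0 < L := by
      rw [hLdef]; unfold sideLength; exact Real.rpow_pos_of_pos (div_pos (by positivity) hρ) _
    have hρL3 : ρ * L ^ 3 = (n + 2 : ℕ) := by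
      have h := div_sideLength_pow_three hρ (N := n + 2) (by omega)
      rw [← hLdef] at h
      field_simp at h
      linarith
    have hM : 1 ≤ L * (Λ * Real.sqrt (ρ * a)) / (2 * Real.pi) := by
      rw [le_div_iff₀ (by positivity), one_mul]
      have := mul_le_mul_of_nonneg_right hML hK₀.le
      rwa [div_mul_cancel₀ _ hK₀.ne'] at this
    have hmin : ∀ t : ℝ, 0 < t → t ≤ 1 → ∃ Ψ : PeriodicTrialState (n + 2) L,
        periodicEnergy (fun r => ENNReal.ofReal t * v r) Ψ =
          periodicGroundStateEnergy (fun r => ENNReal.ofReal t * v r) (n + 2) L ∧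
        periodicEnergy (fun r => ENNReal.ofReal t * v r) Ψ ≠ ⊤ ∧ ContDiff ℝ 3 Ψ.ψ := by
      intro t ht _
      obtain ⟨hw1, hw2, hw3, hw4⟩ := smoothClass_smul hv hfin hC2 hedge ht.le
      exact hMin _ hw1 hw2 hw3 hw4 (n + 2) (by positivity) L hL
    choose Ψt hΨE hΨfin hΨC3 using hmin
    have hdich : ∀ (t : ℝ) (ht : 0 < t) (ht1 : t ≤ 1),
        condensateOccupation (n + 2) L (Ψt t ht ht1).ψ ≤ ENNReal.ofReal (((n + 2 : ℕ) : ℝ) / 4) ∨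
          ENNReal.ofReal (3 * ((n + 2 : ℕ) : ℝ) / 4) ≤ condensateOccupation (n + 2) L (Ψt t ht ht1).ψ := by
      intro t ht ht1
      refine dichotomy_of_instances hmeas hR hR₀ hfin hC2 hCₑ hedge' ha hΛ hΛ2 hρ ht ht1 hL hρL3 h2R hℓL hRℓ hM
        (hg ρ hρ hρg') (Ψt t ht ht1) ?_ ?_ ?_ ?_ ?_
      · exact h4 _ (fun r hr => smul_eq_zero_of_range hR t r hr) (Ψt t ht ht1) (hΨE t ht ht1)
      · intro p hp
        exact hCSR v hv hfin hC2 hedge R₀ hR₀ hR t ht ht1 (n + 2) L h2R (Ψt t ht ht1) (hΨC3 t ht ht1)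
          (hΨE t ht ht1) (hΨfin t ht ht1) p hp
      · exact h2 t ht ht1 (Ψt t ht ht1) (hΨE t ht ht1) (hΨfin t ht ht1)
      · exact h3 t ht ht1 (Ψt t ht ht1) (hΨE t ht ht1) (hΨfin t ht ht1)
      · exact h1 t ht ht1 (Ψt t ht ht1) (hΨE t ht ht1) (hΨfin t ht ht1)
    obtain ⟨δc, hδc, hCont⟩ := hCC v hv hfin hC2 hedge (n + 2) L hL (1 / 8) (by norm_num)
    obtain ⟨Ψc, hΨc0, hnc⟩ := exists_constState hL (n + 2)
    have hw0 : (fun r => ENNReal.ofReal 0 * v r) = 0 := by funext r; simp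
    have hEc : periodicEnergy (fun r => ENNReal.ofReal 0 * v r) Ψc =
        periodicGroundStateEnergy (fun r => ENNReal.ofReal 0 * v r) (n + 2) L := by
      rw [hw0, hΨc0, periodicGroundStateEnergy_zero hL]
    have hEcfin : periodicEnergy (fun r => ENNReal.ofReal 0 * v r) Ψc ≠ ⊤ := by
      rw [hw0, hΨc0]; exact ENNReal.zero_ne_top
    set Nr : ℝ := ((n + 2 : ℕ) : ℝ) with hNr
    have hNr0 : 0 < Nr := by rw [hNr]; positivity
    have hind : ∀ m : ℕ, ∀ (t : ℝ) (ht : 0 < t) (ht1 : t ≤ 1), t ≤ m * (δc / 2) →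
        ENNReal.ofReal (3 * Nr / 4) ≤ condensateOccupation (n + 2) L (Ψt t ht ht1).ψ := by
      intro m
      induction m with
      | zero =>
        intro t ht ht1 htm
        simp only [Nat.cast_zero, zero_mul] at htm
        linarith
      | succ m ih =>
        intro t ht ht1 htm
        by_cases hsmall : t < δc
        · -- compare with the constant state
          have h := hCont 0 t le_rfl zero_le_one ht.le ht1 (by rw [zero_sub, abs_neg, abs_of_pos ht]; exact hsmall)
            Ψc (Ψt t ht ht1) hEc hEcfin (hΨE t ht ht1) (hΨfin t ht ht1)
          rw [hnc] at h
          have h' : ENNReal.ofReal Nr ≤ condensateOccupation (n + 2) L (Ψt t ht ht1).ψ + ENNReal.ofReal (1 / 8 * Nr) := by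
            rwa [hNr, ENNReal.ofReal_natCast]
          refine le_trans (ENNReal.ofReal_le_ofReal (by linarith)) (ofReal_sub_le_of_le_add (by positivity) (by linarith) h')
        · -- one step back along the path
          push Not at hsmall
          have ht' : 0 < t - δc / 2 := by linarith
          have ht'1 : t - δc / 2 ≤ 1 := by linarith
          have htm' : t - δc / 2 ≤ m * (δc / 2) := by push_cast at htm; linarith
          have hprev := ih (t - δc / 2) ht' ht'1 htm'
          have h := hCont (t - δc / 2) t ht'.le ht'1 ht.le ht1
            (by rw [show t - δc / 2 - t = -(δc / 2) by ring, abs_neg, abs_of_pos (by positivity)]; linarith)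
            (Ψt (t - δc / 2) ht' ht'1) (Ψt t ht ht1) (hΨE _ ht' ht'1) (hΨfin _ ht' ht'1) (hΨE t ht ht1) (hΨfin t ht ht1)
          have h58 : ENNReal.ofReal (3 * Nr / 4 - 1 / 8 * Nr) ≤ condensateOccupation (n + 2) L (Ψt t ht ht1).ψ :=
            ofReal_sub_le_of_le_add (by positivity) (by linarith) (hprev.trans h)
          rcases hdich t ht ht1 with hlow | hhigh
          · exfalso
            have := (ENNReal.ofReal_le_ofReal_iff (by positivity)).1 (h58.trans hlow)
            linarith
          · exact hhigh
    set m₁ : ℕ := ⌈2 / δc⌉₊ + 1 with hm₁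
    have h34 : ENNReal.ofReal (3 * Nr / 4) ≤ condensateOccupation (n + 2) L (Ψt 1 one_pos le_rfl).ψ := by
      refine hind m₁ 1 one_pos le_rfl ?_
      have hceil : 2 / δc ≤ (⌈2 / δc⌉₊ : ℝ) := Nat.le_ceil _
      rw [hm₁]; push_cast
      have : 2 / δc * (δc / 2) = 1 := by field_simp
      nlinarith [hceil, hδc]
    have hE1 : periodicEnergy v (Ψt 1 one_pos le_rfl) = periodicGroundStateEnergy v (n + 2) L := by
      have h := hΨE 1 one_pos le_rfl; rwa [smul_one_eq v] at h
    have hE1fin : periodicGroundStateEnergy v (n + 2) L ≠ ⊤ := by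
      have h := hΨfin 1 one_pos le_rfl; rwa [smul_one_eq v, hE1] at h
    obtain ⟨δ, hδ, hstab⟩ := hNMS v hv hfin hC2 hedge (n + 2) L hL hE1fin (1 / 4) (by norm_num)
    refine ⟨δ, hδ, fun Φ hΦ => ?_⟩
    have h := h34.trans (hstab (Ψt 1 one_pos le_rfl) Φ hE1 hΦ)
    have h' := ofReal_sub_le_of_le_add (x := condensateOccupation (n + 2) L Φ.ψ) (by positivity) (by linarith) h
    refine le_trans (le_of_eq ?_) h'
    congr 1
    rw [hNr]
    ring

end Summit.AtomisticToContinuum.BoseEinsteinCondensation.Theorems.SumRuleChainGlue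

end
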